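import Literature.MathematicalPhysics.QuantumFieldTheory.Federbush1986.MajorSublattice
import Literature.MathematicalPhysics.QuantumFieldTheory.Federbush1986.NiceBlockAxialGauge

/-!
# Federbush [F3] §5.3 3) p. 303 «The bonds assigned ε inside a block in the Balaban axial gauge will also be assigned ε in the
# nice block sublattice. This in general will not define a gauge inside the nice block.» — PROVED: the surviving bonds of the
# Bałaban axial (comb) gauge do NOT span the block punctured by an interior ball (the shadow above the ball is cut off)

statement-level skeleton of published theorems with citation tags; proofs where landed; nothing here is a claim about the Yang–Mills mass gap

SOURCE. [Federbush1987PhaseCellIII] P. Federbush, *A phase cell approach to Yang–Mills theory III*, Commun. Math. Phys. **110** (1987)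
293–309, §5.3 3) p. 303 (held `paper:url-4700a514f365`, PDF p. 11): *«3) The bonds assigned ε inside a block in the Balaban axial
gauge will also be assigned ε in the nice block sublattice. This in general will not define a gauge inside the nice block. We assign
ε to a sufficient number of additional bonds to define an axial gauge in each nice block.»*

CITATION HEADER (lean-in-tree rule).  lit-balaban cell (HOME `run/shared/lean/pub/lit-balaban/`), Phase-2 proof seat p26 (gen 15;
free-target protocol G.5-34(d)), SKELETON row **F3.Eq5.26-5.40** step 3) (owner r17, referee ref-5; no head change).  The NEGATIVE half
of step 3): the positive half («We assign ε to a sufficient number of additional bonds to define an axial gauge») is this thread's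
`PuncturedBlockPeeling.niceTree` (p315721: surviving comb ∪ connectors), `BoxMinusBoxesPeeling.axTree` (p323345: ∪ threading bonds;
`axTree_eq_of_top` «= the surviving Bałaban axial gauge + additional bonds») and p32's `NiceBlockAxialGauge.exists_axialGauge_extension`
(p315329: every tree of surviving bonds extends to a spanning one); the prose of `PuncturedBlockPeeling`'s header («what is lost are the
vertical comb bonds through K, which disconnects the SHADOW {x̄ ∈ K̄, x_τ > khi_τ} from the corner») is made a theorem here.  Nothing edited.

WHAT IS PROVED (block `[lo, hi] ⊂ ℤ^{n+2}`, removed box `K = [klo, khi]` in its interior, the comb = Bałaban axial gauge of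
`CombGaugeObservation.combTree lo hi` with initial point the corner `lo` and the LAST coordinate `τ = n + 1` as top direction):
* `shadow klo khi` — the sites `x` with `klo_i ≦ x_i ≦ khi_i` for `i ≠ τ` and `x_τ > khi_τ` (the columns above the ball);
  `lo_not_mem_shadow`; **`mem_shadow_iff_of_survComb`** — every SURVIVING comb bond (both endpoints outside `K`) has both endpoints in
  the shadow or both outside it (horizontal comb bonds lie in the floor levels `x_τ = lo_τ`; a vertical bond entering the shadow from
  below starts in `K`).
* **`not_spans_survComb`** — `¬ Spans (combTree lo hi ∩ survBonds lo hi K) (survBonds lo hi K) lo`: the surviving comb bonds are NOT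
  a (complete axial) gauge of the nice block — the shadow vertex `(klo₀, …, khi_τ + 1)` carries surviving bonds but no surviving comb
  path from the corner reaches it (p32's crossing lemma `NiceBlockAxialGauge.exists_crossing`); `not_spans_survComb_of_not_mem` —
  the same from any base point outside the shadow.

HONEST SCOPE.  Print's «in general» is witnessed for every block with one interior removed box (every `n`, `d = n + 2 ≥ 2`); no claim
about which families of balls leave the comb spanning.  Theorems only plus two `def`s with bodies (`shadow`, `shadowVertex`; `τ` an abbreviation); no new named facts, no `sorry`,
axioms standard.  Unit `lit-balaban-p26` (literature-prover-lit-balaban-p26-g15-0).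
-/

namespace Literature.MathematicalPhysics.QuantumFieldTheory.Federbush1986

namespace SurvivingComb

open LatticeContour SimplyConnectedBox SimplyConnectedBoxMinusBox CombGaugeObservation MajorSublattice NiceBlockAxialGauge

variable {n : ℕ}

/-- The top direction of the comb (the last leg of the contours `Γ_{lo,x}`). [cite: Federbush1987PhaseCellIII, §5.3 3) p. 303] -/
abbrev τ (n : ℕ) : Fin (n + 2) := Fin.last (n + 1)

/-- Every direction is `≦ τ`. [cite: Federbush1987PhaseCellIII, §5.3 3) p. 303] -/
theorem le_τ (i : Fin (n + 2)) : i ≤ τ n := Fin.le_last i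

/-- THE SHADOW of the removed box `K = [klo, khi]`: the sites above it in the top direction, `klo_i ≦ x_i ≦ khi_i` (`i ≠ τ`),
`x_τ > khi_τ`. [cite: Federbush1987PhaseCellIII, §5.3 3) p. 303] -/
def shadow (klo khi : Site (n + 2)) : Set (Site (n + 2)) :=
  {x | (∀ i, i ≠ τ n → klo i ≤ x i ∧ x i ≤ khi i) ∧ khi (τ n) < x (τ n)}

/-- Membership in the shadow. [cite: Federbush1987PhaseCellIII, §5.3 3) p. 303] -/
theorem mem_shadow {klo khi x : Site (n + 2)} :
    x ∈ shadow klo khi ↔ (∀ i, i ≠ τ n → klo i ≤ x i ∧ x i ≤ khi i) ∧ khi (τ n) < x (τ n) := Iff.rfl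

variable {lo hi klo khi : Site (n + 2)}

/-- The corner (base point of the axial gauge) is not in the shadow of an interior box. [cite: Federbush1987PhaseCellIII, §5.3 3) p. 303] -/
theorem lo_not_mem_shadow (hK : ∀ i, lo i < klo i ∧ klo i ≤ khi i ∧ khi i < hi i) : lo ∉ shadow klo khi := by
  intro h
  have h1 := (mem_shadow.1 h).2
  have h2 := hK (τ n)
  omega

/-- **Surviving comb bonds do not cross the boundary of the shadow**: a comb bond of the block with both endpoints outside
`K = [klo, khi]` has its two endpoints both in the shadow or both outside it — horizontal comb bonds lie at `x_τ = lo_τ < klo_τ`, and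
the vertical bond entering the shadow from below starts at a site of `K`. [cite: Federbush1987PhaseCellIII, §5.3 3) p. 303] -/
theorem mem_shadow_iff_of_survComb (hK : ∀ i, lo i < klo i ∧ klo i ≤ khi i ∧ khi i < hi i) {b : Bond (n + 2)}
    (hb : b ∈ combTree lo hi ∩ survBonds lo hi (boxSites klo khi)) : b.1 ∈ shadow klo khi ↔ b.1 + ev b.2 ∈ shadow klo khi := by
  obtain ⟨hcomb, hsurv⟩ := hb
  obtain ⟨-, htop⟩ := mem_combTree.1 hcomb
  obtain ⟨-, h1K, -⟩ := hsurv
  obtain ⟨x, μ⟩ := b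
  simp only at htop h1K ⊢
  by_cases hμ : μ = τ n
  · -- vertical bond
    subst hμ
    constructor
    · intro hx
      refine mem_shadow.2 ⟨fun i hi => ?_, ?_⟩
      · rw [add_ev_apply, if_neg hi, add_zero]; exact (mem_shadow.1 hx).1 i hi
      · rw [add_ev_apply, if_pos rfl]; have := (mem_shadow.1 hx).2; omega
    · intro hx
      obtain ⟨hoff, hτ⟩ := mem_shadow.1 hx
      rw [add_ev_apply, if_pos rfl] at hτ
      have hoff' : ∀ i, i ≠ τ n → klo i ≤ x i ∧ x i ≤ khi i := fun i hi => by
        have := hoff i hi; rwa [add_ev_apply, if_neg hi, add_zero] at this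
      refine mem_shadow.2 ⟨hoff', ?_⟩
      -- if `x_τ ≦ khi_τ` then `x_τ = khi_τ` and `x ∈ K`
      by_contra hle
      apply h1K
      refine mem_boxSites.2 fun i => ?_
      by_cases hi : i = τ n
      · subst hi; have := (hK (τ n)).2.1; omega
      · exact hoff' i hi
  · -- horizontal comb bond: at the floor level `x_τ = lo_τ`
    have hlt : μ < τ n := lt_of_le_of_ne (le_τ μ) hμ
    have hxτ : x (τ n) = lo (τ n) := htop (τ n) hlt
    have hno : ∀ y : Site (n + 2), y (τ n) = lo (τ n) → y ∉ shadow klo khi := fun y hy hys => by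
      have := (mem_shadow.1 hys).2; have := hK (τ n); omega
    have h2 : (x + ev μ) (τ n) = lo (τ n) := by rw [add_ev_apply, if_neg (ne_of_gt hlt), add_zero, hxτ]
    exact ⟨fun h => absurd h (hno x hxτ), fun h => absurd h (hno _ h2)⟩

/-- THE SHADOW VERTEX `v = (klo₀, …, klo_n, khi_τ + 1)` just above the ball. [cite: Federbush1987PhaseCellIII, §5.3 3) p. 303] -/
def shadowVertex (klo khi : Site (n + 2)) : Site (n + 2) := Function.update klo (τ n) (khi (τ n) + 1)

/-- [cite: Federbush1987PhaseCellIII, §5.3 3) p. 303] -/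
theorem shadowVertex_apply_τ : shadowVertex klo khi (τ n) = khi (τ n) + 1 := by
  rw [shadowVertex, Function.update_self]

/-- [cite: Federbush1987PhaseCellIII, §5.3 3) p. 303] -/
theorem shadowVertex_apply_of_ne {i : Fin (n + 2)} (hi : i ≠ τ n) : shadowVertex klo khi i = klo i := by
  rw [shadowVertex, Function.update_of_ne hi]

/-- The shadow vertex lies in the shadow. [cite: Federbush1987PhaseCellIII, §5.3 3) p. 303] -/
theorem shadowVertex_mem_shadow (hK : ∀ i, lo i < klo i ∧ klo i ≤ khi i ∧ khi i < hi i) :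
    shadowVertex klo khi ∈ shadow klo khi := by
  refine mem_shadow.2 ⟨fun i hi => ?_, ?_⟩
  · rw [shadowVertex_apply_of_ne hi]; exact ⟨le_rfl, (hK i).2.1⟩
  · rw [shadowVertex_apply_τ]; omega

/-- Sites strictly above the ball are outside it. [cite: Federbush1987PhaseCellIII, §5.3 3) p. 303] -/
theorem not_mem_K_of_lt {x : Site (n + 2)} (hx : khi (τ n) < x (τ n)) : x ∉ boxSites klo khi := fun h => by
  have h1 := (mem_boxSites.1 h (τ n)).2
  omega

/-- `e₀` is not the top direction. [cite: Federbush1987PhaseCellIII, §5.3 3) p. 303] -/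
theorem zero_ne_τ : (0 : Fin (n + 2)) ≠ τ n := by
  intro h; have := congrArg Fin.val h; simp [Fin.last] at this

/-- The `e₀`-bond leaving the shadow vertex is a bond of the nice block (both endpoints in the block and above the ball).
[cite: Federbush1987PhaseCellIII, §5.3 3) p. 303] -/
theorem shadowBond_mem_survBonds (hK : ∀ i, lo i < klo i ∧ klo i ≤ khi i ∧ khi i < hi i) :
    ((shadowVertex klo khi, (0 : Fin (n + 2))) : Bond (n + 2)) ∈ survBonds lo hi (boxSites klo khi) := by
  have h1 : shadowVertex klo khi ∈ boxSites lo hi := mem_boxSites.2 fun i => by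
    by_cases hi : i = τ n
    · rw [hi, shadowVertex_apply_τ]; have := hK (τ n); omega
    · rw [shadowVertex_apply_of_ne hi]; have := hK i; omega
  have h2 : shadowVertex klo khi + ev 0 ∈ boxSites lo hi := mem_boxSites.2 fun i => by
    rw [add_ev_apply]
    by_cases hi : i = τ n
    · rw [hi, shadowVertex_apply_τ, if_neg zero_ne_τ.symm]; have := hK (τ n); omega
    · rw [shadowVertex_apply_of_ne hi]; have := hK i; split_ifs <;> omega
  have h3 : khi (τ n) < (shadowVertex klo khi + ev 0 : Site (n + 2)) (τ n) := by
    rw [add_ev_apply, shadowVertex_apply_τ, if_neg zero_ne_τ.symm]; omega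
  have h4 : khi (τ n) < shadowVertex klo khi (τ n) := by rw [shadowVertex_apply_τ]; omega
  exact ⟨mem_boxBonds.2 ⟨h1, h2⟩, not_mem_K_of_lt h4, not_mem_K_of_lt h3⟩

/-- No base point outside the shadow spans the nice block through surviving comb bonds. [cite: Federbush1987PhaseCellIII, §5.3 3) p. 303] -/
theorem not_spans_survComb_of_not_mem (hK : ∀ i, lo i < klo i ∧ klo i ≤ khi i ∧ khi i < hi i) {x₀ : Site (n + 2)}
    (hx₀ : x₀ ∉ shadow klo khi) :
    ¬ Spans (combTree lo hi ∩ survBonds lo hi (boxSites klo khi)) (survBonds lo hi (boxSites klo khi)) x₀ := by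
  intro hsp
  obtain ⟨ρ, hρ, hT⟩ := hsp ((shadowVertex klo khi, (0 : Fin (n + 2))), true) (shadowBond_mem_survBonds hK)
  rw [src_true] at hρ
  have hJ : Joined (combTree lo hi ∩ survBonds lo hi (boxSites klo khi)) x₀ (shadowVertex klo khi) := ⟨ρ, hρ, hT⟩
  obtain ⟨b, hb, hcross⟩ := exists_crossing (S := (shadow klo khi)ᶜ) (Set.mem_compl hx₀)
    (fun h => h (shadowVertex_mem_shadow hK)) hJ
  have key := mem_shadow_iff_of_survComb hK hb
  simp only [Set.mem_compl_iff] at hcross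
  tauto

/-- **«This in general will not define a gauge inside the nice block.»**  For a block `[lo, hi] ⊂ ℤ^{n+2}` punctured by an interior
box `K = [klo, khi]`, the bonds «assigned ε inside a block in the Balaban axial gauge» that survive in the nice block sublattice — the
comb bonds with both endpoints outside `K` — do NOT span it from the corner (the base point of the comb): no path of surviving comb
bonds joins `lo` to the shadow vertex above the ball, although that vertex carries surviving bonds.
[cite: Federbush1987PhaseCellIII, §5.3 3) p. 303] -/
theorem not_spans_survComb (hK : ∀ i, lo i < klo i ∧ klo i ≤ khi i ∧ khi i < hi i) :
    ¬ Spans (combTree lo hi ∩ survBonds lo hi (boxSites klo khi)) (survBonds lo hi (boxSites klo khi)) lo :=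
  not_spans_survComb_of_not_mem hK (lo_not_mem_shadow hK)

end SurvivingComb

end Literature.MathematicalPhysics.QuantumFieldTheory.Federbush1986
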